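import Literature.Analysis.FunctionSpaces.WeakDerivInner
import Literature.Analysis.FunctionSpaces.SobolevTraceDensityProofs
import Mathlib.Analysis.InnerProductSpace.PiL2
import Mathlib.MeasureTheory.Function.L2Space
import HarnessLib

/-!
# LINE 25 «CompactnessTransfer» (K2 crux `BlockLipschitzL` stmt-QuantumFields-23533 ∕ crux `HistoryTailL` stmt-QuantumFields-19936), S1″ row (C)
# «MinimisingMapCompactness» proof project (w2 g13 lineage, LEAD w1 g10 GO 13:49:46Z), brick (C-c) «SHELL INTERPOLATION»:
# the cut-off interpolant `w = χv + (1−χ)u` of two unit Sobolev maps is Sobolev, sub-unit, and its energy density is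
# `≤ 3·(dens ∇v + dens ∇u + L²‖v − u‖²)` pointwise (`‖∇χ‖ ≤ L`)

Cell `ym3-torus` (YM ladder rung R3 = continuum SU(2) Yang–Mills on the three-torus — a RUNG, NOT the Clay problem: not `d = 4`, not infinite volume,
not a mass gap); width seat `ym-ust-19936-w4` gen 15, second hand on (C-c) (w2 g13 2026-08-29T14:10:32Z «(C-c) YOURS — GO», letters frozen there).
THEOREMS ONLY (def-free); `--supports` the K2 crux as a helper.  LETTERS (w2's, verbatim): maps `u v : ℝ³ → ℝ⁴` on an open `Ω` with weak gradients
`Gu, Gv` (lit `HasWeakFDerivOn Ω volume`), `‖u‖ = ‖v‖ = 1` on `Ω`, the S1″ density `dens G x := Σᵢ ‖G x (single i 1)‖²`; a cut-off `χ : ℝ³ → ℝ`,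
`ContDiff ℝ ∞ χ`, `0 ≤ χ ≤ 1`, `‖fderiv ℝ χ x‖ ≤ L`; the competitor `w x = χ x • v x + (1 − χ x) • u x` and its gradient
`Gw x = χ x • Gv x + (1 − χ x) • Gu x + (fderiv ℝ χ x).smulRight (v x − u x)` — both carried as variables with defining hypotheses `hw`, `hGw`.
* §1 letters: `sum_sq_apply_single_le_opNorm_sq` (`Σᵢ (ℓ eᵢ)² ≤ ‖ℓ‖²` for a functional on `ℝ³`), `norm_sq_add_add_le_three`,
  ★`dens_interpolant_le` — THE POINTWISE ROW `dens Gw x ≤ 3·(dens Gv x + dens Gu x + L²·‖v x − u x‖²)` (pure algebra, every `x`).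
* §2 ★★`hasWeakFDerivOn_interpolant` — (i) `HasWeakFDerivOn Ω volume w Gw` (lit ✓`HasWeakFDerivOn.smul_contDiff` twice + ✓`SobolevApprox.hasWeakFDerivOn_add`);
  `norm_interpolant_le_one` — (ii) `‖w x‖ ≤ 1` on `Ω`; `interpolant_eq_of_chi_eq_one` ∕ `interpolant_eq_of_chi_eq_zero` — (iv).
* §3 ★★`setIntegral_dens_interpolant_le` — (iii) on every measurable `S ⊆ Ω` of finite volume: `IntegrableOn (dens Gw) S` and
  `∫_S dens Gw ≤ 3·(∫_S dens Gv + ∫_S dens Gu + L²·∫_S ‖v − u‖²)` (the finite-volume side condition is what makes `‖v − u‖²` integrable on a general `Ω`;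
  it is automatic on the cube).
HONEST: a Sobolev letter; (C) `MinimisingMapCompactness`, (RS), S1″, S2♭″, the organ, K1, `MeanDeviationL`, `BlockLipschitzL`, `HistoryTailL` are NOT proved
here.  [folklore] ([Evans2010] §5.2.3 Thm 1 (iv) product rule; [Simon1996] §2.8 the cut-off comparison map; [HardtKinderlehrerLin1986] §2).
-/

set_option autoImplicit false

noncomputable section

open MeasureTheory Set Filter Topology TopologicalSpace
open scoped NNReal BigOperators ContDiff

namespace Summit.QuantumFields.YangMills.Theorems.PoincareLipschitzSobolevShellInterpolation

open Literature.Analysis.FunctionSpaces (HasWeakFDerivOn)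
open Literature.Analysis.FunctionSpaces.SobolevApprox (hasWeakFDerivOn_add)

/-! ## §1 Pointwise letters -/

/-- For a continuous linear functional `ℓ` on `ℝ³`: `Σᵢ (ℓ eᵢ)² ≤ ‖ℓ‖²` (test `ℓ` on `y := Σᵢ (ℓ eᵢ) eᵢ`). [folklore] -/
theorem sum_sq_apply_single_le_opNorm_sq (ℓ : EuclideanSpace ℝ (Fin 3) →L[ℝ] ℝ) :
    ∑ i : Fin 3, (ℓ (EuclideanSpace.single i (1:ℝ))) ^ 2 ≤ ‖ℓ‖ ^ 2 := by
  set c : Fin 3 → ℝ := fun i => ℓ (EuclideanSpace.single i (1:ℝ)) with hc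
  set y : EuclideanSpace ℝ (Fin 3) := ∑ i : Fin 3, c i • EuclideanSpace.single i (1:ℝ) with hy
  have hyi : ∀ i : Fin 3, y i = c i := by
    intro i
    simp only [hy, WithLp.ofLp_sum, WithLp.ofLp_smul, Finset.sum_apply, Pi.smul_apply, PiLp.single_apply,
      smul_eq_mul, mul_ite, mul_one, mul_zero, Finset.sum_ite_eq, Finset.mem_univ, if_true]
  have hS0 : 0 ≤ ∑ i : Fin 3, c i ^ 2 := Finset.sum_nonneg fun i _ => sq_nonneg _
  have hnormy : ‖y‖ = Real.sqrt (∑ i : Fin 3, c i ^ 2) := by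
    rw [EuclideanSpace.norm_eq]
    congr 1
    exact Finset.sum_congr rfl fun i _ => by rw [hyi, Real.norm_eq_abs, sq_abs]
  have hℓy : ℓ y = ∑ i : Fin 3, c i ^ 2 := by
    simp only [hy, map_sum, map_smul, smul_eq_mul, hc]
    exact Finset.sum_congr rfl fun i _ => by ring
  have hle : ∑ i : Fin 3, c i ^ 2 ≤ ‖ℓ‖ * Real.sqrt (∑ i : Fin 3, c i ^ 2) := by
    have h := ℓ.le_opNorm y
    rw [hℓy, Real.norm_eq_abs, abs_of_nonneg hS0, hnormy] at h
    exact h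
  by_cases hS : ∑ i : Fin 3, c i ^ 2 = 0
  · rw [show (∑ i : Fin 3, (ℓ (EuclideanSpace.single i (1:ℝ))) ^ 2) = ∑ i : Fin 3, c i ^ 2 from rfl, hS]
    positivity
  · have hpos : 0 < Real.sqrt (∑ i : Fin 3, c i ^ 2) := Real.sqrt_pos.2 (lt_of_le_of_ne hS0 (Ne.symm hS))
    have hsq : Real.sqrt (∑ i : Fin 3, c i ^ 2) * Real.sqrt (∑ i : Fin 3, c i ^ 2) = ∑ i : Fin 3, c i ^ 2 :=
      Real.mul_self_sqrt hS0
    have h1 : Real.sqrt (∑ i : Fin 3, c i ^ 2) ≤ ‖ℓ‖ := by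
      have h2 : Real.sqrt (∑ i : Fin 3, c i ^ 2) * Real.sqrt (∑ i : Fin 3, c i ^ 2) ≤ ‖ℓ‖ * Real.sqrt (∑ i : Fin 3, c i ^ 2) := by
        rw [hsq]; exact hle
      exact le_of_mul_le_mul_right h2 hpos
    calc ∑ i : Fin 3, (ℓ (EuclideanSpace.single i (1:ℝ))) ^ 2 = ∑ i : Fin 3, c i ^ 2 := rfl
      _ = Real.sqrt (∑ i : Fin 3, c i ^ 2) ^ 2 := by rw [sq, hsq]
      _ ≤ ‖ℓ‖ ^ 2 := pow_le_pow_left₀ hpos.le h1 2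

/-- `‖a + b + c‖² ≤ 3(‖a‖² + ‖b‖² + ‖c‖²)`. [folklore] -/
theorem norm_sq_add_add_le_three {F : Type*} [NormedAddCommGroup F] (a b c : F) :
    ‖a + b + c‖ ^ 2 ≤ 3 * (‖a‖ ^ 2 + ‖b‖ ^ 2 + ‖c‖ ^ 2) := by
  have h := norm_add₃_le (a := a) (b := b) (c := c)
  nlinarith [norm_nonneg (a + b + c), norm_nonneg a, norm_nonneg b, norm_nonneg c,
    sq_nonneg (‖a‖ - ‖b‖), sq_nonneg (‖b‖ - ‖c‖), sq_nonneg (‖a‖ - ‖c‖)]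

/-- ★ **THE POINTWISE ENERGY ROW OF THE INTERPOLANT.**  With `0 ≤ χ x ≤ 1`, `‖fderiv ℝ χ x‖ ≤ L` and
`Gw x = χ x • Gv x + (1 − χ x) • Gu x + (fderiv ℝ χ x).smulRight (v x − u x)`:
`Σᵢ ‖Gw x eᵢ‖² ≤ 3·(Σᵢ ‖Gv x eᵢ‖² + Σᵢ ‖Gu x eᵢ‖² + L²·‖v x − u x‖²)` — for EVERY `x`. [folklore] -/
theorem dens_interpolant_le {u v : EuclideanSpace ℝ (Fin 3) → EuclideanSpace ℝ (Fin 4)}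
    {Gu Gv Gw : EuclideanSpace ℝ (Fin 3) → (EuclideanSpace ℝ (Fin 3) →L[ℝ] EuclideanSpace ℝ (Fin 4))}
    {χ : EuclideanSpace ℝ (Fin 3) → ℝ} {L : ℝ} (hχ01 : ∀ x, 0 ≤ χ x ∧ χ x ≤ 1) (hχL : ∀ x, ‖fderiv ℝ χ x‖ ≤ L)
    (hGw : ∀ x, Gw x = χ x • Gv x + (1 - χ x) • Gu x + (fderiv ℝ χ x).smulRight (v x - u x)) (x : EuclideanSpace ℝ (Fin 3)) :
    ∑ i : Fin 3, ‖Gw x (EuclideanSpace.single i (1:ℝ))‖ ^ 2 ≤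
      3 * (∑ i : Fin 3, ‖Gv x (EuclideanSpace.single i (1:ℝ))‖ ^ 2 + ∑ i : Fin 3, ‖Gu x (EuclideanSpace.single i (1:ℝ))‖ ^ 2 +
        L ^ 2 * ‖v x - u x‖ ^ 2) := by
  have hL0 : 0 ≤ L := le_trans (norm_nonneg _) (hχL x)
  have hχ0 := (hχ01 x).1
  have hχ1 := (hχ01 x).2
  -- per direction
  have hdir : ∀ i : Fin 3, ‖Gw x (EuclideanSpace.single i (1:ℝ))‖ ^ 2 ≤
      3 * (‖Gv x (EuclideanSpace.single i (1:ℝ))‖ ^ 2 + ‖Gu x (EuclideanSpace.single i (1:ℝ))‖ ^ 2 +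
        (fderiv ℝ χ x (EuclideanSpace.single i (1:ℝ))) ^ 2 * ‖v x - u x‖ ^ 2) := by
    intro i
    have happ : Gw x (EuclideanSpace.single i (1:ℝ)) =
        χ x • Gv x (EuclideanSpace.single i (1:ℝ)) + (1 - χ x) • Gu x (EuclideanSpace.single i (1:ℝ)) +
          (fderiv ℝ χ x (EuclideanSpace.single i (1:ℝ))) • (v x - u x) := by
      rw [hGw x]
      simp [ContinuousLinearMap.smulRight_apply]
    rw [happ]
    refine (norm_sq_add_add_le_three _ _ _).trans ?_
    have h1 : ‖χ x • Gv x (EuclideanSpace.single i (1:ℝ))‖ ^ 2 ≤ ‖Gv x (EuclideanSpace.single i (1:ℝ))‖ ^ 2 := by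
      rw [norm_smul, Real.norm_eq_abs, abs_of_nonneg hχ0, mul_pow]
      have : χ x ^ 2 ≤ 1 := by nlinarith
      nlinarith [sq_nonneg ‖Gv x (EuclideanSpace.single i (1:ℝ))‖]
    have h2 : ‖(1 - χ x) • Gu x (EuclideanSpace.single i (1:ℝ))‖ ^ 2 ≤ ‖Gu x (EuclideanSpace.single i (1:ℝ))‖ ^ 2 := by
      rw [norm_smul, Real.norm_eq_abs, abs_of_nonneg (by linarith), mul_pow]
      have : (1 - χ x) ^ 2 ≤ 1 := by nlinarith
      nlinarith [sq_nonneg ‖Gu x (EuclideanSpace.single i (1:ℝ))‖]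
    have h3 : ‖(fderiv ℝ χ x (EuclideanSpace.single i (1:ℝ))) • (v x - u x)‖ ^ 2 =
        (fderiv ℝ χ x (EuclideanSpace.single i (1:ℝ))) ^ 2 * ‖v x - u x‖ ^ 2 := by
      rw [norm_smul, Real.norm_eq_abs, mul_pow, sq_abs]
    linarith
  -- the cut-off row `Σᵢ (∂ᵢχ)² ≤ ‖∇χ‖² ≤ L²`
  have hχsum : ∑ i : Fin 3, (fderiv ℝ χ x (EuclideanSpace.single i (1:ℝ))) ^ 2 ≤ L ^ 2 :=
    (sum_sq_apply_single_le_opNorm_sq (fderiv ℝ χ x)).trans (pow_le_pow_left₀ (norm_nonneg _) (hχL x) 2)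
  have hvu0 : 0 ≤ ‖v x - u x‖ ^ 2 := sq_nonneg _
  calc ∑ i : Fin 3, ‖Gw x (EuclideanSpace.single i (1:ℝ))‖ ^ 2
      ≤ ∑ i : Fin 3, 3 * (‖Gv x (EuclideanSpace.single i (1:ℝ))‖ ^ 2 + ‖Gu x (EuclideanSpace.single i (1:ℝ))‖ ^ 2 +
          (fderiv ℝ χ x (EuclideanSpace.single i (1:ℝ))) ^ 2 * ‖v x - u x‖ ^ 2) := Finset.sum_le_sum fun i _ => hdir i
    _ = 3 * (∑ i : Fin 3, ‖Gv x (EuclideanSpace.single i (1:ℝ))‖ ^ 2 + ∑ i : Fin 3, ‖Gu x (EuclideanSpace.single i (1:ℝ))‖ ^ 2 +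
          (∑ i : Fin 3, (fderiv ℝ χ x (EuclideanSpace.single i (1:ℝ))) ^ 2) * ‖v x - u x‖ ^ 2) := by
        rw [← Finset.mul_sum, Finset.sum_add_distrib, Finset.sum_add_distrib, Finset.sum_mul]
    _ ≤ 3 * (∑ i : Fin 3, ‖Gv x (EuclideanSpace.single i (1:ℝ))‖ ^ 2 + ∑ i : Fin 3, ‖Gu x (EuclideanSpace.single i (1:ℝ))‖ ^ 2 +
          L ^ 2 * ‖v x - u x‖ ^ 2) := by
        have := mul_le_mul_of_nonneg_right hχsum hvu0
        linarith

/-! ## §2 The interpolant is Sobolev and sub-unit -/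

/-- ★★ **(i) THE INTERPOLANT IS SOBOLEV with the product-rule gradient**: `HasWeakFDerivOn Ω volume w Gw` for `w = χ•v + (1−χ)•u`,
`Gw = χ•Gv + (1−χ)•Gu + (∇χ) ⊗ (v − u)` (lit ✓`HasWeakFDerivOn.smul_contDiff` on each summand + ✓`SobolevApprox.hasWeakFDerivOn_add`). [folklore] -/
theorem hasWeakFDerivOn_interpolant {Ω : Opens (EuclideanSpace ℝ (Fin 3))}
    {u v w : EuclideanSpace ℝ (Fin 3) → EuclideanSpace ℝ (Fin 4)}
    {Gu Gv Gw : EuclideanSpace ℝ (Fin 3) → (EuclideanSpace ℝ (Fin 3) →L[ℝ] EuclideanSpace ℝ (Fin 4))}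
    (hu : HasWeakFDerivOn Ω volume u Gu) (hv : HasWeakFDerivOn Ω volume v Gv)
    {χ : EuclideanSpace ℝ (Fin 3) → ℝ} (hχ : ContDiff ℝ ∞ χ)
    (hw : ∀ x, w x = χ x • v x + (1 - χ x) • u x)
    (hGw : ∀ x, Gw x = χ x • Gv x + (1 - χ x) • Gu x + (fderiv ℝ χ x).smulRight (v x - u x)) :
    HasWeakFDerivOn Ω volume w Gw := by
  have hχ' : ContDiff ℝ ∞ (fun x => 1 - χ x) := contDiff_const.sub hχ
  have h1 := hv.smul_contDiff hχ
  have h2 := hu.smul_contDiff hχ'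
  have h12 := hasWeakFDerivOn_add h1 h2
  have ef : ((fun x => χ x • v x) + fun x => (1 - χ x) • u x) = w := by
    funext x
    rw [Pi.add_apply, hw x]
  have eg : ((fun x => (fderiv ℝ χ x).smulRight (v x) + χ x • Gv x) +
      fun x => (fderiv ℝ (fun x => 1 - χ x) x).smulRight (u x) + (1 - χ x) • Gu x) = Gw := by
    funext x
    rw [Pi.add_apply, hGw x, fderiv_const_sub]
    ext y
    simp [ContinuousLinearMap.smulRight_apply, smul_sub, sub_smul]
    abel
  rw [ef, eg] at h12
  exact h12

/-- **(ii) the interpolant is sub-unit**: `‖w x‖ ≤ 1` wherever `‖u x‖ = ‖v x‖ = 1` and `0 ≤ χ x ≤ 1`. [folklore] -/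
theorem norm_interpolant_le_one {u v w : EuclideanSpace ℝ (Fin 3) → EuclideanSpace ℝ (Fin 4)}
    {χ : EuclideanSpace ℝ (Fin 3) → ℝ} (hχ01 : ∀ x, 0 ≤ χ x ∧ χ x ≤ 1)
    (hw : ∀ x, w x = χ x • v x + (1 - χ x) • u x) {x : EuclideanSpace ℝ (Fin 3)}
    (hu1 : ‖u x‖ = 1) (hv1 : ‖v x‖ = 1) : ‖w x‖ ≤ 1 := by
  rw [hw x]
  have hχ0 := (hχ01 x).1
  have hχ1 := (hχ01 x).2
  calc ‖χ x • v x + (1 - χ x) • u x‖ ≤ ‖χ x • v x‖ + ‖(1 - χ x) • u x‖ := norm_add_le _ _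
    _ = χ x + (1 - χ x) := by
        rw [norm_smul, norm_smul, Real.norm_eq_abs, Real.norm_eq_abs, abs_of_nonneg hχ0, abs_of_nonneg (by linarith),
          hv1, hu1, mul_one, mul_one]
    _ = 1 := by ring

/-- **(iv-a)** where `χ = 1` the interpolant is `v`. [folklore] -/
theorem interpolant_eq_of_chi_eq_one {u v w : EuclideanSpace ℝ (Fin 3) → EuclideanSpace ℝ (Fin 4)}
    {χ : EuclideanSpace ℝ (Fin 3) → ℝ} (hw : ∀ x, w x = χ x • v x + (1 - χ x) • u x) {x : EuclideanSpace ℝ (Fin 3)}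
    (hx : χ x = 1) : w x = v x := by
  rw [hw x, hx]; simp

/-- **(iv-b)** where `χ = 0` the interpolant is `u`. [folklore] -/
theorem interpolant_eq_of_chi_eq_zero {u v w : EuclideanSpace ℝ (Fin 3) → EuclideanSpace ℝ (Fin 4)}
    {χ : EuclideanSpace ℝ (Fin 3) → ℝ} (hw : ∀ x, w x = χ x • v x + (1 - χ x) • u x) {x : EuclideanSpace ℝ (Fin 3)}
    (hx : χ x = 0) : w x = u x := by
  rw [hw x, hx]; simp

/-! ## §3 The integrated energy row on finite-volume measurable pieces of `Ω` -/

/-- ★★ **(iii) THE SHELL ENERGY ROW.**  For measurable `S ⊆ Ω` of finite volume: `dens Gw` is integrable on `S` and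
`∫_S dens Gw ≤ 3·(∫_S dens Gv + ∫_S dens Gu + L²·∫_S ‖v − u‖²)`. [folklore] [cite: Simon1996, §2.8] -/
theorem setIntegral_dens_interpolant_le {Ω : Opens (EuclideanSpace ℝ (Fin 3))}
    {u v w : EuclideanSpace ℝ (Fin 3) → EuclideanSpace ℝ (Fin 4)}
    {Gu Gv Gw : EuclideanSpace ℝ (Fin 3) → (EuclideanSpace ℝ (Fin 3) →L[ℝ] EuclideanSpace ℝ (Fin 4))}
    (hu : HasWeakFDerivOn Ω volume u Gu) (hv : HasWeakFDerivOn Ω volume v Gv)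
    (hu1 : ∀ x ∈ (Ω : Set (EuclideanSpace ℝ (Fin 3))), ‖u x‖ = 1) (hv1 : ∀ x ∈ (Ω : Set (EuclideanSpace ℝ (Fin 3))), ‖v x‖ = 1)
    (hdu : IntegrableOn (fun x => ∑ i : Fin 3, ‖Gu x (EuclideanSpace.single i (1:ℝ))‖ ^ 2) (Ω : Set _) volume)
    (hdv : IntegrableOn (fun x => ∑ i : Fin 3, ‖Gv x (EuclideanSpace.single i (1:ℝ))‖ ^ 2) (Ω : Set _) volume)
    {χ : EuclideanSpace ℝ (Fin 3) → ℝ} {L : ℝ} (hχ : ContDiff ℝ ∞ χ) (hχ01 : ∀ x, 0 ≤ χ x ∧ χ x ≤ 1) (hχL : ∀ x, ‖fderiv ℝ χ x‖ ≤ L)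
    (hw : ∀ x, w x = χ x • v x + (1 - χ x) • u x)
    (hGw : ∀ x, Gw x = χ x • Gv x + (1 - χ x) • Gu x + (fderiv ℝ χ x).smulRight (v x - u x))
    {S : Set (EuclideanSpace ℝ (Fin 3))} (hS : MeasurableSet S) (hSΩ : S ⊆ (Ω : Set _)) (hSfin : volume S < ⊤) :
    IntegrableOn (fun x => ∑ i : Fin 3, ‖Gw x (EuclideanSpace.single i (1:ℝ))‖ ^ 2) S volume ∧
    ∫ x in S, ∑ i : Fin 3, ‖Gw x (EuclideanSpace.single i (1:ℝ))‖ ^ 2 ≤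
      3 * ((∫ x in S, ∑ i : Fin 3, ‖Gv x (EuclideanSpace.single i (1:ℝ))‖ ^ 2) +
        (∫ x in S, ∑ i : Fin 3, ‖Gu x (EuclideanSpace.single i (1:ℝ))‖ ^ 2) + L ^ 2 * ∫ x in S, ‖v x - u x‖ ^ 2) := by
  haveI : IsFiniteMeasure (volume.restrict S) := ⟨by rw [Measure.restrict_apply_univ]; exact hSfin⟩
  have hle : volume.restrict S ≤ volume.restrict (Ω : Set _) := Measure.restrict_mono hSΩ le_rfl
  -- measurability of the pieces on `S`
  have hW := hasWeakFDerivOn_interpolant hu hv hχ hw hGw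
  have hGwm : AEStronglyMeasurable Gw (volume.restrict S) := (hW.locallyIntegrableOn_deriv.aestronglyMeasurable).mono_measure hle
  have hum : AEStronglyMeasurable u (volume.restrict S) := (hu.locallyIntegrableOn.aestronglyMeasurable).mono_measure hle
  have hvm : AEStronglyMeasurable v (volume.restrict S) := (hv.locallyIntegrableOn.aestronglyMeasurable).mono_measure hle
  have hdensm : AEStronglyMeasurable (fun x => ∑ i : Fin 3, ‖Gw x (EuclideanSpace.single i (1:ℝ))‖ ^ 2) (volume.restrict S) := by
    refine Finset.aestronglyMeasurable_fun_sum _ fun i _ => ?_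
    have h1 : AEStronglyMeasurable (fun x => ‖Gw x (EuclideanSpace.single i (1:ℝ))‖ ^ 2) (volume.restrict S) :=
      ((hGwm.apply_continuousLinearMap (EuclideanSpace.single i (1:ℝ))).norm.pow 2)
    exact h1
  -- `‖v − u‖²` is integrable on `S` (bounded by `4`, finite volume)
  have hvum : AEStronglyMeasurable (fun x => ‖v x - u x‖ ^ 2) (volume.restrict S) := (hvm.sub hum).norm.pow 2
  have hvuint : IntegrableOn (fun x => ‖v x - u x‖ ^ 2) S volume := by
    refine memLp_one_iff_integrable.1 (MemLp.of_bound hvum 4 ?_)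
    refine (ae_restrict_iff' hS).mpr (ae_of_all _ fun x hx => ?_)
    rw [Real.norm_of_nonneg (by positivity)]
    have h := norm_sub_le (v x) (u x)
    rw [hv1 x (hSΩ hx), hu1 x (hSΩ hx)] at h
    nlinarith [norm_nonneg (v x - u x)]
  -- the dominating function
  have hdom : IntegrableOn (fun x => 3 * ((∑ i : Fin 3, ‖Gv x (EuclideanSpace.single i (1:ℝ))‖ ^ 2) +
      (∑ i : Fin 3, ‖Gu x (EuclideanSpace.single i (1:ℝ))‖ ^ 2) + L ^ 2 * ‖v x - u x‖ ^ 2)) S volume :=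
    (((hdv.mono_set hSΩ).add (hdu.mono_set hSΩ)).add (hvuint.const_mul (L ^ 2))).const_mul 3
  have hptw := dens_interpolant_le (u := u) (v := v) hχ01 hχL hGw
  have hint : IntegrableOn (fun x => ∑ i : Fin 3, ‖Gw x (EuclideanSpace.single i (1:ℝ))‖ ^ 2) S volume := by
    refine Integrable.mono' hdom hdensm (ae_of_all _ fun x => ?_)
    rw [Real.norm_of_nonneg (Finset.sum_nonneg fun i _ => by positivity)]
    exact hptw x
  refine ⟨hint, ?_⟩
  calc ∫ x in S, ∑ i : Fin 3, ‖Gw x (EuclideanSpace.single i (1:ℝ))‖ ^ 2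
      ≤ ∫ x in S, 3 * ((∑ i : Fin 3, ‖Gv x (EuclideanSpace.single i (1:ℝ))‖ ^ 2) +
          (∑ i : Fin 3, ‖Gu x (EuclideanSpace.single i (1:ℝ))‖ ^ 2) + L ^ 2 * ‖v x - u x‖ ^ 2) :=
        setIntegral_mono_on hint hdom hS fun x _ => hptw x
    _ = 3 * ((∫ x in S, ∑ i : Fin 3, ‖Gv x (EuclideanSpace.single i (1:ℝ))‖ ^ 2) +
          (∫ x in S, ∑ i : Fin 3, ‖Gu x (EuclideanSpace.single i (1:ℝ))‖ ^ 2) + L ^ 2 * ∫ x in S, ‖v x - u x‖ ^ 2) := by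
        have hAB : IntegrableOn (fun x => (∑ i : Fin 3, ‖Gv x (EuclideanSpace.single i (1:ℝ))‖ ^ 2) +
            (∑ i : Fin 3, ‖Gu x (EuclideanSpace.single i (1:ℝ))‖ ^ 2)) S volume := (hdv.mono_set hSΩ).add (hdu.mono_set hSΩ)
        have hC : IntegrableOn (fun x => L ^ 2 * ‖v x - u x‖ ^ 2) S volume := hvuint.const_mul (L ^ 2)
        have e1 : ∫ x in S, ((∑ i : Fin 3, ‖Gv x (EuclideanSpace.single i (1:ℝ))‖ ^ 2) +
            (∑ i : Fin 3, ‖Gu x (EuclideanSpace.single i (1:ℝ))‖ ^ 2) + L ^ 2 * ‖v x - u x‖ ^ 2) =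
            (∫ x in S, ((∑ i : Fin 3, ‖Gv x (EuclideanSpace.single i (1:ℝ))‖ ^ 2) +
              (∑ i : Fin 3, ‖Gu x (EuclideanSpace.single i (1:ℝ))‖ ^ 2))) + ∫ x in S, L ^ 2 * ‖v x - u x‖ ^ 2 :=
          integral_add hAB hC
        have e2 : ∫ x in S, ((∑ i : Fin 3, ‖Gv x (EuclideanSpace.single i (1:ℝ))‖ ^ 2) +
            (∑ i : Fin 3, ‖Gu x (EuclideanSpace.single i (1:ℝ))‖ ^ 2)) =
            (∫ x in S, ∑ i : Fin 3, ‖Gv x (EuclideanSpace.single i (1:ℝ))‖ ^ 2) +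
              ∫ x in S, ∑ i : Fin 3, ‖Gu x (EuclideanSpace.single i (1:ℝ))‖ ^ 2 :=
          integral_add (hdv.mono_set hSΩ) (hdu.mono_set hSΩ)
        have e3 : ∫ x in S, L ^ 2 * ‖v x - u x‖ ^ 2 = L ^ 2 * ∫ x in S, ‖v x - u x‖ ^ 2 := integral_const_mul _ _
        rw [integral_const_mul, e1, e2, e3]

end Summit.QuantumFields.YangMills.Theorems.PoincareLipschitzSobolevShellInterpolation

end
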